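import Literature.AnabelianGeometry.SemiGraphs.CosetCategoriesPullComp
import Literature.AnabelianGeometry.SemiGraphs.CosetCategoriesPullConj
import Literature.IUT.HodgeTheaters.ConventionsCatIsomorphismGroup
import Literature.IUT.HodgeTheaters.PiAvatarOrbitCategoryAut
import Literature.IUT.HodgeTheaters.PiAvatarBaseKitThetaNFInstances
import HarnessLib

/-!
# [IUTchI] §0 / Def 4.1 (i) / Cor 5.3 (ii): ambient automorphisms of the Π-avatar `𝒟_v̲` READ AS §0-isomorphisms of `ℬ(Π_v̲)⁰`
# — the hom `ρ : Aut_{Amb}(𝒟_v̲) →* Aut(CosetCat Π_v̲)` of the lift-kind slot, generic and at the kit of record (L5 base-merge race, racer B, FILE 2)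

S. Mochizuki, *Inter-universal Teichmüller theory I*, kurims manuscript (May 2020), §0 «Categories» p. 33 («isomorphism `C → D`» =
isomorphism class of equivalences; for connected anabelioids `ℬ(Π)⁰` these are the outer isomorphisms of `Π`), Def 4.1 (i) p. 95
(«`†𝒟_v` … a category equivalent to `𝒟_v`»), Def 6.1 (v) p. 158 («`Aut_K(X̲_K)` … inside `Π_{C_K}`»), Cor 5.3 (ii) p. 144
(«the natural map `Isom(¹𝔉, ²𝔉) → Isom(¹𝔇, ²𝔇)`»; proof l. 41–45 «surjectivity … from the construction; … injectivity … over the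
identity self-equivalence of `𝒟_v`») ([IUTchI] Def 4.1 (i) p.95) [claim: Mochizuki2012, status: disputed] (D-0012 claim key;
GROUP-THEORETIC PLUMBING over abc-iut-L5-t2's small coset categories and abc-iut-L5-t4's Π-avatar ambient; nothing of the series
is asserted; no side is taken on [IUTchIII] Cor. 3.12).  Also [cite: MochizukiFrdII2008, Ex 1.3 (ii) p.11] (the transport functor
`pull`), [cite: MochizukiSemiAnbd2006, Prop 3.2 p.35] (inner automorphisms act trivially on transport).

## What this file builds (cell abc-iut; L5-lead RULINGS #117 (1) PIN (4)(b): racer B owns the lift-kind slot; this is its `ρ`)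

The lift-kind `ℱ`-slot of `GenuineFKitMergeInputs.lean` (racer B FILE 1, p495677) needs, at an index `x` of a kit whose ambient
`K.Amb x` is the Π-avatar `ThetaAmb` (kit of record `baseKitThetaNFOfBadPairs`, abc-iut-w5-d129 p491670), a homomorphism
`ρ : Aut (K.model x) →* CatAut (ℬ(Π_v̲)⁰)` reading an ambient automorphism of `𝒟_v̲` — in the EMBEDDED design a coset transporter
`xΠ_v̲ ↦ x n Π_v̲`, `n ∈ N_{Π_{C_F}}(Π_v̲)` (abc-iut-L5-t4 `OrbitCat.autEquiv`: `Aut(ℬ(H)⁰) ≅ N(H)/H`, p424570) — as the §0-isomorphism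
of the small coset category `CosetCat Π_v̲` (abc-iut-L5-t2) it induces: conjugation by `n` on `Π_v̲`, transported to `CosetCat Π_v̲`
by the pull-back functor ([FrdII] Ex 1.3 (ii)).  Contents (all generic in a topological group, then specialised):
* §A `PiTransport.pullEquivOfInverse φ ψ …` / `pullSelfEquiv` — the equivalence `CosetCat Q ≌ CosetCat P` of a pair of mutually inverse
  continuous homomorphisms (`pull_comp`/`pull_id` of abc-iut-w4-d058 `CosetCategoriesPullComp` make unit/counit identities on the nose)
  and `cosetCatEquivOfEq (h : H₁ = H₂) : CosetCat ↥H₁ ≌ CosetCat ↥H₂` (the seam between `dite`-spelled and unfolded local groups);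
* §B `PiTransport.conjSub H n : ↥H →* ↥H` (conjugation by a normaliser element), `normalizerToCatAut H : ↥N_A(H) →* CatAut (CosetCat ↥H)`
  (a HOMOMORPHISM: `n ↦ [pull (conj n⁻¹)]`), and `normalizerToCatAut_eq_one_of_mem` — elements of `H` act trivially (inner
  automorphisms give isomorphic transport functors, abc-iut-w4-d078 `nonempty_iso_pull_of_forall_conj` p493329);
* §C `PiTransport.orbitAutToCatAut H : Aut (ℬ(H)⁰) →* CatAut (CosetCat ↥H)` through `OrbitCat.autEquiv` (the quotient `N(H)/H`);
* §D `PiTransport.thetaAmbAutToCatAut X : Aut_{ThetaAmb}(X) →* CatAut (CosetCat ↥(X.obj))` through abc-iut-L5-t4's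
  `ThetaAmb.autEquivFull` («`Aut_Θ(X) ≃* Aut_Orbit(X)`», no binder) and the full-subcategory transfer;
* §E AT THE KIT OF RECORD: `InitialThetaData.modelAutToCatAut … x : Aut ((D.baseKitThetaNFOfBadPairs …).model x) →*
  CatAut (CosetCat ↥((D.localDataOfBadPairs … x).H))` — the `ρ_x` of the good/bad `ℱ`-slots, DEFINITIONALLY the §D map at the
  kit's model (`rfl`), under the kit's binders {CG, hS, M, hA, hI, B, ΛBad} only; no new binder, no `Prop` fact.
No instance, no notation; typed ≠ inhabited ≠ proved; nothing here asserts abc proved or refuted.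
-/

noncomputable section

namespace Literature.IUT.HodgeTheaters

open CategoryTheory Literature.AnabelianGeometry.SemiGraphs

universe u

namespace PiTransport

/-! ### §A. Self-equivalences of the small coset category from mutually inverse continuous endomorphisms -/

section SelfEquiv

/-- A left inverse makes an endomorphism surjective. [folklore] -/
private theorem surjective_of_comp_eq_id {P : Type u} [Group P] {Q : Type u} [Group Q] {φ : P →* Q} {ψ : Q →* P}
    (h : φ.comp ψ = MonoidHom.id Q) : Function.Surjective φ :=
  fun x => ⟨ψ x, DFunLike.congr_fun h x⟩

variable {P : Type u} [Group P] [TopologicalSpace P] {Q : Type u} [Group Q] [TopologicalSpace Q]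

/-- **The equivalence `CosetCat Q ≌ CosetCat P` of a pair of mutually inverse continuous homomorphisms** `φ : P → Q`, `ψ : Q → P`
of topological groups: functor `pull φ` (`Q/U ↦ P/φ⁻¹U`), inverse `pull ψ`, unit and counit the identities ON THE NOSE by
`pull φ ⋙ pull ψ = pull (φ ∘ ψ) = pull id = 𝟭` ([FrdII] Ex 1.3 (ii) functoriality of transport; abc-iut-w4-d058 `pull_comp`,
`pull_id`, `pull_congr`). [cite: MochizukiFrdII2008, Ex 1.3 (ii) p.11] -/
def pullEquivOfInverse (φ : P →* Q) (ψ : Q →* P) (hφ : Continuous φ) (hψ : Continuous ψ) (h₁ : φ.comp ψ = MonoidHom.id Q)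
    (h₂ : ψ.comp φ = MonoidHom.id P) : CosetCat Q ≌ CosetCat P :=
  CategoryTheory.Equivalence.mk (CosetCat.pull φ hφ (surjective_of_comp_eq_id h₁))
    (CosetCat.pull ψ hψ (surjective_of_comp_eq_id h₂))
    (eqToIso (by
      rw [CosetCat.pull_comp φ hφ (surjective_of_comp_eq_id h₁) ψ hψ (surjective_of_comp_eq_id h₂)
        (hφ.comp hψ) ((surjective_of_comp_eq_id h₁).comp (surjective_of_comp_eq_id h₂)),
        CosetCat.pull_congr (φ.comp ψ) (MonoidHom.id Q) _ continuous_id _ Function.surjective_id h₁, CosetCat.pull_id]))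
    (eqToIso (by
      rw [CosetCat.pull_comp ψ hψ (surjective_of_comp_eq_id h₂) φ hφ (surjective_of_comp_eq_id h₁)
        (hψ.comp hφ) ((surjective_of_comp_eq_id h₂).comp (surjective_of_comp_eq_id h₁)),
        CosetCat.pull_congr (ψ.comp φ) (MonoidHom.id P) _ continuous_id _ Function.surjective_id h₂, CosetCat.pull_id]))

/-- The functor of `pullEquivOfInverse φ ψ` is `pull φ`. [cite: MochizukiFrdII2008, Ex 1.3 (ii) p.11] -/
theorem pullEquivOfInverse_functor (φ : P →* Q) (ψ : Q →* P) (hφ : Continuous φ) (hψ : Continuous ψ)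
    (h₁ : φ.comp ψ = MonoidHom.id Q) (h₂ : ψ.comp φ = MonoidHom.id P) :
    (pullEquivOfInverse φ ψ hφ hψ h₁ h₂).functor = CosetCat.pull φ hφ (surjective_of_comp_eq_id h₁) := rfl

/-- The inverse of `pullEquivOfInverse φ ψ` is `pull ψ`. [cite: MochizukiFrdII2008, Ex 1.3 (ii) p.11] -/
theorem pullEquivOfInverse_inverse (φ : P →* Q) (ψ : Q →* P) (hφ : Continuous φ) (hψ : Continuous ψ)
    (h₁ : φ.comp ψ = MonoidHom.id Q) (h₂ : ψ.comp φ = MonoidHom.id P) :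
    (pullEquivOfInverse φ ψ hφ hψ h₁ h₂).inverse = CosetCat.pull ψ hψ (surjective_of_comp_eq_id h₂) := rfl

/-- **Equal subgroups have equivalent coset categories, canonically**: `CosetCat ↥H₁ ≌ CosetCat ↥H₂` for `H₁ = H₂` (transport along
the two inclusions) — the seam between a kit's local group spelled through a `dite` (e.g. `localDatumAt … x`) and its unfolded
form at a known place type (`Π_{X̲→_K} ∩ augGF⁻¹ G_v̲`, `(B x h).H`). [cite: MochizukiFrdII2008, Ex 1.3 (ii) p.11] -/
def cosetCatEquivOfEq {A : Type u} [Group A] [TopologicalSpace A] {H₁ H₂ : Subgroup A} (h : H₁ = H₂) :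
    CosetCat ↥H₁ ≌ CosetCat ↥H₂ :=
  pullEquivOfInverse (Subgroup.inclusion h.symm.le) (Subgroup.inclusion h.le)
    (Continuous.subtype_mk continuous_subtype_val _) (Continuous.subtype_mk continuous_subtype_val _)
    (MonoidHom.ext fun _ => rfl) (MonoidHom.ext fun _ => rfl)

/-- Special case `P = Q`: the self-equivalence of a pair of mutually inverse continuous endomorphisms.
[cite: MochizukiFrdII2008, Ex 1.3 (ii) p.11] -/
abbrev pullSelfEquiv (φ ψ : P →* P) (hφ : Continuous φ) (hψ : Continuous ψ) (h₁ : φ.comp ψ = MonoidHom.id P)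
    (h₂ : ψ.comp φ = MonoidHom.id P) : CosetCat P ≌ CosetCat P :=
  pullEquivOfInverse φ ψ hφ hψ h₁ h₂

/-- The functor of `pullSelfEquiv φ ψ` is `pull φ`. [cite: MochizukiFrdII2008, Ex 1.3 (ii) p.11] -/
theorem pullSelfEquiv_functor (φ ψ : P →* P) (hφ : Continuous φ) (hψ : Continuous ψ) (h₁ : φ.comp ψ = MonoidHom.id P)
    (h₂ : ψ.comp φ = MonoidHom.id P) :
    (pullSelfEquiv φ ψ hφ hψ h₁ h₂).functor = CosetCat.pull φ hφ (surjective_of_comp_eq_id h₁) := rfl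

end SelfEquiv

/-! ### §B. Conjugation by the normaliser on a subgroup, and the induced §0-isomorphisms of its coset category -/

section Conj

variable {A : Type u} [Group A] (H : Subgroup A)

/-- **Conjugation `x ↦ n x n⁻¹` on `H` by an element `n` of its normaliser** (Def 6.1 (v): the ambient group acting on the
embedded `Π`'s), as an endomorphism of the group `↥H`. ([IUTchI] Def 6.1 (v) p.158) [claim: Mochizuki2012, status: disputed] -/
def conjSub (n : ↥(Subgroup.normalizer (H : Set A))) : ↥H →* ↥H where
  toFun x := ⟨(n : A) * x * (n : A)⁻¹, (Subgroup.mem_normalizer_iff.mp n.2 x).mp x.2⟩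
  map_one' := Subtype.ext (by simp)
  map_mul' x y := Subtype.ext (by
    change (n : A) * (x * y) * (n : A)⁻¹ = (n : A) * x * (n : A)⁻¹ * ((n : A) * y * (n : A)⁻¹)
    group)

/-- `conjSub H n x = n x n⁻¹`. ([IUTchI] Def 6.1 (v) p.158) [claim: Mochizuki2012, status: disputed] -/
@[simp] theorem coe_conjSub (n : ↥(Subgroup.normalizer (H : Set A))) (x : ↥H) :
    ((conjSub H n x : ↥H) : A) = (n : A) * x * (n : A)⁻¹ := rfl

/-- `conj (n m) = conj n ∘ conj m`. ([IUTchI] Def 6.1 (v) p.158) [claim: Mochizuki2012, status: disputed] -/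
theorem conjSub_mul (n m : ↥(Subgroup.normalizer (H : Set A))) : conjSub H (n * m) = (conjSub H n).comp (conjSub H m) := by
  ext x
  change ((n : A) * m) * x * ((n : A) * m)⁻¹ = (n : A) * ((m : A) * x * (m : A)⁻¹) * (n : A)⁻¹
  group

/-- `conj 1 = id`. ([IUTchI] Def 6.1 (v) p.158) [claim: Mochizuki2012, status: disputed] -/
theorem conjSub_one : conjSub H 1 = MonoidHom.id ↥H := by
  ext x
  change ((1 : A)) * x * (1 : A)⁻¹ = x
  group

/-- `conj n⁻¹ ∘ conj n = id`. ([IUTchI] Def 6.1 (v) p.158) [claim: Mochizuki2012, status: disputed] -/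
theorem conjSub_inv_comp (n : ↥(Subgroup.normalizer (H : Set A))) : (conjSub H n⁻¹).comp (conjSub H n) = MonoidHom.id ↥H := by
  rw [← conjSub_mul, inv_mul_cancel, conjSub_one]

/-- `conj n ∘ conj n⁻¹ = id`. ([IUTchI] Def 6.1 (v) p.158) [claim: Mochizuki2012, status: disputed] -/
theorem conjSub_comp_inv (n : ↥(Subgroup.normalizer (H : Set A))) : (conjSub H n).comp (conjSub H n⁻¹) = MonoidHom.id ↥H := by
  rw [← conjSub_mul, mul_inv_cancel, conjSub_one]

end Conj

section Normalizer

variable {A : Type u} [Group A] [TopologicalSpace A] [IsTopologicalGroup A] (H : Subgroup A)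

/-- Conjugation is continuous (subspace topology). ([IUTchI] Def 6.1 (v) p.158) [claim: Mochizuki2012, status: disputed] -/
theorem continuous_conjSub (n : ↥(Subgroup.normalizer (H : Set A))) : Continuous (conjSub H n) := by
  apply Continuous.subtype_mk
  exact (continuous_const.mul continuous_subtype_val).mul continuous_const

/-- **The §0-isomorphism of `CosetCat H` induced by a normaliser element** `n`: transport along `conj n⁻¹` (functor
`H/U ↦ H/nUn⁻¹`), inverse transport along `conj n` — the self-equivalence of `ℬ(H)⁰` «arising from» the ambient automorphism
`n` of the embedded object (Def 6.1 (v); Cor 5.3 proof «automorphisms of `𝒟_v` … arise from …»).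
([IUTchI] Def 6.1 (v) p.158) [claim: Mochizuki2012, status: disputed] -/
def conjSelfEquiv (n : ↥(Subgroup.normalizer (H : Set A))) : CosetCat ↥H ≌ CosetCat ↥H :=
  pullSelfEquiv (conjSub H n⁻¹) (conjSub H n) (continuous_conjSub H n⁻¹) (continuous_conjSub H n) (conjSub_inv_comp H n)
    (conjSub_comp_inv H n)

/-- The functor of `conjSelfEquiv H n` is `pull (conj n⁻¹)`. ([IUTchI] Def 6.1 (v) p.158) [claim: Mochizuki2012, status: disputed] -/
theorem conjSelfEquiv_functor (n : ↥(Subgroup.normalizer (H : Set A))) :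
    (conjSelfEquiv H n).functor = CosetCat.pull (conjSub H n⁻¹) (continuous_conjSub H n⁻¹)
      (surjective_of_comp_eq_id (conjSub_inv_comp H n)) := rfl

/-- **`N_A(H) → Aut(CosetCat H)`, `n ↦ [pull (conj n⁻¹)]`, is a HOMOMORPHISM of groups** (transport is functorial in the
augmentation ON THE NOSE: `pull a ⋙ pull b = pull (a ∘ b)`, `pull id = 𝟭`; with abc-iut-L5-t4's `Aut(C)` law `a * b = b.comp a`).
([IUTchI] §0 p.33) [claim: Mochizuki2012, status: disputed] -/
def normalizerToCatAut : ↥(Subgroup.normalizer (H : Set A)) →* CatAut (CosetCat ↥H) where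
  toFun n := CatIsomorphism.mk (conjSelfEquiv H n)
  map_one' := by
    rw [CatAut.one_def, CatIsomorphism.refl_eq_mk]
    refine CatIsomorphism.sound (eqToIso ?_)
    rw [conjSelfEquiv_functor]
    change _ = 𝟭 (CosetCat ↥H)
    rw [CosetCat.pull_congr (conjSub H 1⁻¹) (MonoidHom.id ↥H) _ continuous_id _ Function.surjective_id
      (by rw [inv_one, conjSub_one]), CosetCat.pull_id]
  map_mul' n m := by
    rw [CatAut.mul_def, CatIsomorphism.mk_comp_mk]
    refine CatIsomorphism.sound (eqToIso ?_)
    change (conjSelfEquiv H (n * m)).functor = (conjSelfEquiv H m).functor ⋙ (conjSelfEquiv H n).functor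
    rw [conjSelfEquiv_functor, conjSelfEquiv_functor, conjSelfEquiv_functor,
      CosetCat.pull_comp (conjSub H m⁻¹) (continuous_conjSub H m⁻¹) (surjective_of_comp_eq_id (conjSub_inv_comp H m))
        (conjSub H n⁻¹) (continuous_conjSub H n⁻¹) (surjective_of_comp_eq_id (conjSub_inv_comp H n))
        ((continuous_conjSub H m⁻¹).comp (continuous_conjSub H n⁻¹))
        ((surjective_of_comp_eq_id (conjSub_inv_comp H m)).comp (surjective_of_comp_eq_id (conjSub_inv_comp H n)))]
    exact CosetCat.pull_congr _ _ _ _ _ _ (by rw [← conjSub_mul, mul_inv_rev])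

/-- `normalizerToCatAut H n` is the class of `conjSelfEquiv H n`. ([IUTchI] §0 p.33) [claim: Mochizuki2012, status: disputed] -/
theorem normalizerToCatAut_apply (n : ↥(Subgroup.normalizer (H : Set A))) :
    normalizerToCatAut H n = CatIsomorphism.mk (conjSelfEquiv H n) := rfl

/-- **Elements of `H` act trivially**: conjugation by `h ∈ H` is an INNER automorphism of `↥H`, and inner automorphisms give
transport functors isomorphic to the identity ([SemiAnbd] Prop 3.2: isomorphism classes of transport functors = conjugacy classes;
abc-iut-w4-d078 `nonempty_iso_pull_of_forall_conj`, `pull_id`). So `N_A(H) → Aut(CosetCat H)` factors through `N_A(H)/H = Aut(ℬ(H)⁰)`.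
[cite: MochizukiSemiAnbd2006, Prop 3.2 p.35] -/
theorem normalizerToCatAut_eq_one_of_mem (n : ↥(Subgroup.normalizer (H : Set A))) (hn : (n : A) ∈ H) :
    normalizerToCatAut H n = 1 := by
  rw [normalizerToCatAut_apply, CatAut.one_def, CatIsomorphism.refl_eq_mk]
  refine CatIsomorphism.sound ?_
  rw [conjSelfEquiv_functor]
  change CosetCat.pull (conjSub H n⁻¹) _ _ ≅ 𝟭 (CosetCat ↥H)
  rw [← CosetCat.pull_id (G := ↥H)]
  -- `conj n⁻¹ (n π n⁻¹) = π`: the two augmentations differ by the inner automorphism of `x := ⟨n, hn⟩ ∈ H`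
  have hx : ∀ π : ↥H, conjSub H n⁻¹ ((⟨(n : A), hn⟩ : ↥H) * π * (⟨(n : A), hn⟩ : ↥H)⁻¹) = (MonoidHom.id ↥H) π := by
    intro π
    apply Subtype.ext
    change ((n⁻¹ : ↥(Subgroup.normalizer (H : Set A))) : A) * ((n : A) * π * (n : A)⁻¹) *
      ((n⁻¹ : ↥(Subgroup.normalizer (H : Set A))) : A)⁻¹ = π
    rw [Subgroup.coe_inv]
    group
  exact (CosetCat.nonempty_iso_pull_of_forall_conj (MonoidHom.id ↥H) (conjSub H n⁻¹) continuous_id Function.surjective_id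
    (continuous_conjSub H n⁻¹) (surjective_of_comp_eq_id (conjSub_inv_comp H n)) ⟨(n : A), hn⟩ hx).some

/-- `H ∩ N_A(H)` lies in the kernel of `normalizerToCatAut`. [cite: MochizukiSemiAnbd2006, Prop 3.2 p.35] -/
theorem subgroupOf_normalizer_le_ker :
    H.subgroupOf (Subgroup.normalizer (H : Set A)) ≤ (normalizerToCatAut H).ker := fun n hn =>
  (MonoidHom.mem_ker).mpr (normalizerToCatAut_eq_one_of_mem H n (Subgroup.mem_subgroupOf.mp hn))

/-! ### §C. `Aut(ℬ(H)⁰) → Aut(CosetCat H)` through `Aut(ℬ(H)⁰) ≅ N_A(H)/H` -/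

/-- **`ρ` on the orbit category: `Aut(ℬ(H)⁰) →* Aut(CosetCat H)`** — an ambient automorphism of the embedded connected object
`A/H` (a class of `N_A(H)/H`, abc-iut-L5-t4 `OrbitCat.autEquiv` p424570) READ AS the §0-isomorphism of the small coset category it
induces («isomorphisms of `ℬ(Π)⁰`-objects correspond to outer isomorphisms», §0 p. 33; Def 4.1 (i)).
([IUTchI] Def 4.1 (i) p.95) [claim: Mochizuki2012, status: disputed] -/
def orbitAutToCatAut : Aut (OrbitCat.of H : OrbitCat A) →* CatAut (CosetCat ↥H) :=
  (QuotientGroup.lift (H.subgroupOf (Subgroup.normalizer (H : Set A))) (normalizerToCatAut H)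
      (subgroupOf_normalizer_le_ker H)).comp
    (OrbitCat.autEquiv H).symm.toMonoidHom

/-- `orbitAutToCatAut` on the automorphism of a normaliser element `n` (abc-iut-L5-t4's `autOfNormalizerHom H n`, i.e.
`xH ↦ x n⁻¹ H`) is `[pull (conj n⁻¹)]`. ([IUTchI] Def 4.1 (i) p.95) [claim: Mochizuki2012, status: disputed] -/
theorem orbitAutToCatAut_autOfNormalizerHom (n : ↥(Subgroup.normalizer (H : Set A))) :
    orbitAutToCatAut H (OrbitCat.autOfNormalizerHom H n) = normalizerToCatAut H n := by
  have h1 : (OrbitCat.autEquiv H).symm (OrbitCat.autOfNormalizerHom H n) = QuotientGroup.mk n := by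
    rw [← OrbitCat.autEquiv_mk, MulEquiv.symm_apply_apply]
  simp only [orbitAutToCatAut, MonoidHom.comp_apply, MulEquiv.coe_toMonoidHom, h1, QuotientGroup.lift_mk]

end Normalizer

/-! ### §D. The same for the transporter-or-degenerate ambient `ThetaAmb` (the kit of record's `Amb v`) -/

section Theta

variable {A : Type u} [Group A] [TopologicalSpace A] [IsTopologicalGroup A] {G : Type u} [Group G] (aug : A →* G)
  (P : ObjectProperty (OrbitCat A)) (X : P.FullSubcategory)

/-- **`ρ` on the Π-avatar ambient `ThetaAmb`**: an automorphism of an object in play `X` (abc-iut-L5-t4 `ThetaAmb.autEquivFull`: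
`Aut_Θ(X) ≃* Aut_Orbit(X)`, no slimness/rigidity binder — degenerate morphisms are never invertible) READ AS the §0-isomorphism of
`CosetCat ↥(X.obj)` it induces. ([IUTchI] Def 4.1 (i) p.95) [claim: Mochizuki2012, status: disputed] -/
def thetaAmbAutToCatAut : Aut ((ThetaAmb.ι aug P).obj X) →* CatAut (CosetCat ↥(OrbitCat.sub X.obj)) :=
  (orbitAutToCatAut (OrbitCat.sub X.obj)).comp
    (((P.fullyFaithfulι).autMulEquivOfFullyFaithful X).toMonoidHom.comp (ThetaAmb.autEquivFull (aug := aug) X).toMonoidHom)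

/-- Unfolding `thetaAmbAutToCatAut`: underlying orbit-category automorphism, then `orbitAutToCatAut`.
([IUTchI] Def 4.1 (i) p.95) [claim: Mochizuki2012, status: disputed] -/
theorem thetaAmbAutToCatAut_apply (e : Aut ((ThetaAmb.ι aug P).obj X)) :
    thetaAmbAutToCatAut aug P X e =
      orbitAutToCatAut (OrbitCat.sub X.obj) (P.ι.mapIso (ThetaAmb.autEquivFull (aug := aug) X e)) := rfl

end Theta

end PiTransport

/-! ### §E. At the kit of record `baseKitThetaNFOfBadPairs`: `ρ_x : Aut(𝒟_v̲) →* Aut(CosetCat Π_v̲)` at every index -/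

section KitOfRecord

universe uF vK w

variable {F : Type uF} {K : Type vK} {Fbar : Type w} [Field F] [NumberField F] [Field K] [NumberField K]
  [Algebra F K] [Field Fbar] [Algebra F Fbar] [Algebra K Fbar]
  {E : WeierstrassCurve F} [E.IsElliptic] {l : ℕ} {Pb : BadPlacePredicates K}
  (D : InitialThetaData F K Fbar E l Pb) (CG : D.geom.pe.CuspGalois) (hS : D.CuspClassesNormaliserStable) [Fact l.Prime]
  (M : D.TorsionMonodromy) (hA : D.geom.pe.ArrowCoveringClaims)
  (hI : ∀ k ∈ D.geom.pe.inertia D.geom.pe.ε1, M.tau (D.geom.embK k) = 0)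
  (B : ∀ v, v ∈ D.indexCopyBad → D.BadPairAt v) (ΛBad : ∀ v (h : v ∈ D.indexCopyBad), D.LocalArrowLaw CG hS (B v h).H)

namespace InitialThetaData

/-- **`ρ_x` AT THE KIT OF RECORD**: at every index `x ∈ V̲` of abc-iut-w5-d129's genuine-shape Θ-NF kit
`D.baseKitThetaNFOfBadPairs CG hS M hA hI B ΛBad` (ambient `ThetaAmb augGF InPlayNF`, model `𝒟_v̲ = ℬ(Π_v̲)⁰` embedded as the local
datum's `Π_v̲ = (D.localDataOfBadPairs … x).H ≤ Π_{C_F}`), the ambient automorphisms of `𝒟_v̲` READ AS §0-isomorphisms of the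
small coset category `CosetCat Π_v̲` — the `ρ` of racer B's lift-kind `ℱ`-slot (`CatIsomorphism.liftSubgroup p (K.model x) ρ_x`).
Binders: the kit's {CG, hS, M, hA, hI, B, ΛBad}; nothing else. ([IUTchI] Def 4.1 (i) p.95) [claim: Mochizuki2012, status: disputed] -/
def modelAutToCatAut (x : D.IndexCopy) :
    Aut ((D.baseKitThetaNFOfBadPairs CG hS M hA hI B ΛBad).model x) →*
      CatAut (CosetCat ↥((D.localDataOfBadPairs CG hS M hA hI B ΛBad x).H)) :=
  PiTransport.thetaAmbAutToCatAut D.augGF (D.localDataOfBadPairs CG hS M hA hI B ΛBad x).InPlayNF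
    (D.localDataOfBadPairs CG hS M hA hI B ΛBad x).modelNF

/-- `modelAutToCatAut` IS the §D map at the kit's model object (definitional). ([IUTchI] Def 4.1 (i) p.95) [claim: Mochizuki2012, status: disputed] -/
theorem modelAutToCatAut_eq (x : D.IndexCopy) :
    D.modelAutToCatAut CG hS M hA hI B ΛBad x =
      PiTransport.thetaAmbAutToCatAut D.augGF (D.localDataOfBadPairs CG hS M hA hI B ΛBad x).InPlayNF
        (D.localDataOfBadPairs CG hS M hA hI B ΛBad x).modelNF := rfl

end InitialThetaData

end KitOfRecord

end Literature.IUT.HodgeTheaters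

end
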